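import Mathlib

/-!
# Polytope transport — linear algebra of first-coordinate block maps

Helper file for `PolytopeTransport` (stmt-KontsevichZagierPeriods-10815, route ScissorsTransport).
For a linear functional `ℓ` on `ℝⁿ⁺¹` and a linear map `L` on `ℝⁿ` we study the continuous linear map
`consCLM ℓ L : h ↦ Fin.cons (ℓ h) (L (Fin.tail h))` on `ℝⁿ⁺¹`: its matrix is block lower
triangular with blocks `ℓ e₀` and `L`, so `det (consCLM ℓ L) = ℓ e₀ · det L`; and it is the derivative
of maps of the shape `x ↦ Fin.cons (u x) (G (Fin.tail x))`. All folklore linear algebra / calculus.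
-/

noncomputable section

open Set

namespace Summit.KontsevichZagierPeriods.ScissorsTransport.PolytopeTransport

variable {n : ℕ}

/-- The tail projection `ℝⁿ⁺¹ → ℝⁿ`, `h ↦ Fin.tail h`, as a continuous linear map. [folklore] -/
def tailCLM (n : ℕ) : (Fin (n + 1) → ℝ) →L[ℝ] (Fin n → ℝ) :=
  ContinuousLinearMap.pi fun i => ContinuousLinearMap.proj (R := ℝ) (φ := fun _ : Fin (n + 1) => ℝ) i.succ

/-- `tailCLM` is `Fin.tail`. [folklore] -/
@[simp] theorem tailCLM_apply (h : Fin (n + 1) → ℝ) : tailCLM n h = Fin.tail h := rfl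

/-- The block map `h ↦ Fin.cons (ℓ h) (L (Fin.tail h))` on `ℝⁿ⁺¹`. [folklore] -/
def consCLM (ℓ : (Fin (n + 1) → ℝ) →L[ℝ] ℝ) (L : (Fin n → ℝ) →L[ℝ] (Fin n → ℝ)) :
    (Fin (n + 1) → ℝ) →L[ℝ] (Fin (n + 1) → ℝ) :=
  ContinuousLinearMap.pi (Fin.cons (α := fun _ : Fin (n + 1) => (Fin (n + 1) → ℝ) →L[ℝ] ℝ) ℓ
    (fun i => (ContinuousLinearMap.proj (R := ℝ) (φ := fun _ : Fin n => ℝ) i).comp (L.comp (tailCLM n))))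

/-- `consCLM ℓ L h = Fin.cons (ℓ h) (L (Fin.tail h))`. [folklore] -/
@[simp] theorem consCLM_apply (ℓ : (Fin (n + 1) → ℝ) →L[ℝ] ℝ) (L : (Fin n → ℝ) →L[ℝ] (Fin n → ℝ))
    (h : Fin (n + 1) → ℝ) : consCLM ℓ L h = Fin.cons (ℓ h) (L (Fin.tail h)) := by
  ext j
  refine Fin.cases ?_ (fun i => ?_) j
  · simp [consCLM]
  · simp [consCLM]

/-- The tail of the first basis vector vanishes. [folklore] -/
theorem tail_single_zero : Fin.tail (Pi.single (0 : Fin (n + 1)) (1 : ℝ) : Fin (n + 1) → ℝ) = 0 := by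
  ext i
  simp [Fin.tail, Fin.succ_ne_zero]

/-- The tail of a later basis vector is the corresponding basis vector. [folklore] -/
theorem tail_single_succ (j : Fin n) :
    Fin.tail (Pi.single (j.succ : Fin (n + 1)) (1 : ℝ) : Fin (n + 1) → ℝ) = (Pi.single j 1 : Fin n → ℝ) := by
  ext i
  simp [Fin.tail, Pi.single_apply, Fin.succ_inj]

/-- **Determinant of the block map**: `det (consCLM ℓ L) = ℓ e₀ · det L` (block lower-triangular
matrix with diagonal blocks `ℓ e₀` and `L`). [folklore] -/
theorem det_consCLM (ℓ : (Fin (n + 1) → ℝ) →L[ℝ] ℝ) (L : (Fin n → ℝ) →L[ℝ] (Fin n → ℝ)) :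
    (consCLM ℓ L).det = ℓ (Pi.single 0 1 : Fin (n + 1) → ℝ) * L.det := by
  have h1 : (consCLM ℓ L).det = (LinearMap.toMatrix' ((consCLM ℓ L : (Fin (n + 1) → ℝ) →ₗ[ℝ]
      (Fin (n + 1) → ℝ)))).det := by
    rw [LinearMap.det_toMatrix']
  rw [h1]
  set M := LinearMap.toMatrix' ((consCLM ℓ L : (Fin (n + 1) → ℝ) →ₗ[ℝ] (Fin (n + 1) → ℝ))) with hM
  have hMij : ∀ i j, M i j = (Fin.cons (ℓ (Pi.single j 1 : Fin (n + 1) → ℝ))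
      (L (Fin.tail (Pi.single j 1 : Fin (n + 1) → ℝ))) : Fin (n + 1) → ℝ) i := by
    intro i j
    rw [hM, LinearMap.toMatrix'_apply]
    simp
  have hcol : ∀ i : Fin n, M i.succ 0 = 0 := by
    intro i
    rw [hMij, Fin.cons_succ, tail_single_zero, map_zero]
    rfl
  rw [Matrix.det_succ_column_zero, Fin.sum_univ_succ]
  have hrest : ∑ i : Fin n, (-1 : ℝ) ^ ((i.succ : Fin (n + 1)) : ℕ) * M i.succ 0 *
      (M.submatrix (Fin.succAbove i.succ) Fin.succ).det = 0 := by
    refine Finset.sum_eq_zero fun i _ => ?_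
    rw [hcol, mul_zero, zero_mul]
  rw [hrest, add_zero]
  have h00 : M 0 0 = ℓ (Pi.single 0 1 : Fin (n + 1) → ℝ) := by
    rw [hMij, Fin.cons_zero]
  have hsub : M.submatrix (Fin.succAbove (0 : Fin (n + 1))) Fin.succ =
      LinearMap.toMatrix' (L : (Fin n → ℝ) →ₗ[ℝ] (Fin n → ℝ)) := by
    ext i j
    simp only [Matrix.submatrix_apply, Fin.succAbove_zero, LinearMap.toMatrix'_apply, hMij,
      Fin.cons_succ, tail_single_succ]
    rfl
  rw [h00, hsub, LinearMap.det_toMatrix']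
  simp only [Fin.val_zero, pow_zero, one_mul]

/-- `Fin.tail` has strict derivative `tailCLM`. [folklore] -/
theorem hasStrictFDerivAt_tail (x : Fin (n + 1) → ℝ) :
    HasStrictFDerivAt (fun x : Fin (n + 1) → ℝ => Fin.tail x) (tailCLM n) x :=
  (tailCLM n).hasStrictFDerivAt

/-- **Derivative of a first-coordinate block map.** If `u : ℝⁿ⁺¹ → ℝ` has strict derivative `ℓ` at
`x` and `G : ℝⁿ → ℝⁿ` has strict derivative `L` at `Fin.tail x`, then
`x ↦ Fin.cons (u x) (G (Fin.tail x))` has strict derivative `consCLM ℓ L` at `x`. [folklore] -/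
theorem hasStrictFDerivAt_cons {u : (Fin (n + 1) → ℝ) → ℝ} {ℓ : (Fin (n + 1) → ℝ) →L[ℝ] ℝ}
    {G : (Fin n → ℝ) → (Fin n → ℝ)} {L : (Fin n → ℝ) →L[ℝ] (Fin n → ℝ)} {x : Fin (n + 1) → ℝ}
    (hu : HasStrictFDerivAt u ℓ x) (hG : HasStrictFDerivAt G L (Fin.tail x)) :
    HasStrictFDerivAt (fun y : Fin (n + 1) → ℝ => (Fin.cons (u y) (G (Fin.tail y)) : Fin (n + 1) → ℝ))
      (consCLM ℓ L) x := by
  have hGt : HasStrictFDerivAt (fun y : Fin (n + 1) → ℝ => G (Fin.tail y)) (L.comp (tailCLM n)) x :=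
    hG.comp x (hasStrictFDerivAt_tail x)
  rw [hasStrictFDerivAt_pi']
  intro j
  refine Fin.cases ?_ (fun i => ?_) j
  · have h0 : (ContinuousLinearMap.proj (R := ℝ) (φ := fun _ : Fin (n + 1) => ℝ) 0).comp
        (consCLM ℓ L) = ℓ := by
      ext h
      simp
    simpa [h0] using hu
  · have hi : (ContinuousLinearMap.proj (R := ℝ) (φ := fun _ : Fin (n + 1) => ℝ) i.succ).comp
        (consCLM ℓ L) = (ContinuousLinearMap.proj (R := ℝ) (φ := fun _ : Fin n => ℝ) i).comp
          (L.comp (tailCLM n)) := by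
      ext h
      simp
    have := (hasStrictFDerivAt_pi'.1 hGt) i
    simpa [hi] using this

/-- Non-strict version of `hasStrictFDerivAt_cons` within a set. [folklore] -/
theorem hasFDerivWithinAt_cons {u : (Fin (n + 1) → ℝ) → ℝ} {ℓ : (Fin (n + 1) → ℝ) →L[ℝ] ℝ}
    {G : (Fin n → ℝ) → (Fin n → ℝ)} {L : (Fin n → ℝ) →L[ℝ] (Fin n → ℝ)} {x : Fin (n + 1) → ℝ}
    {s : Set (Fin (n + 1) → ℝ)} {t : Set (Fin n → ℝ)}
    (hu : HasFDerivWithinAt u ℓ s x) (hG : HasFDerivWithinAt G L t (Fin.tail x))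
    (hst : MapsTo (fun y : Fin (n + 1) → ℝ => Fin.tail y) s t) :
    HasFDerivWithinAt (fun y : Fin (n + 1) → ℝ => (Fin.cons (u y) (G (Fin.tail y)) : Fin (n + 1) → ℝ))
      (consCLM ℓ L) s x := by
  have hGt : HasFDerivWithinAt (fun y : Fin (n + 1) → ℝ => G (Fin.tail y)) (L.comp (tailCLM n)) s x :=
    hG.comp x (hasStrictFDerivAt_tail x).hasFDerivAt.hasFDerivWithinAt hst
  rw [hasFDerivWithinAt_pi']
  intro j
  refine Fin.cases ?_ (fun i => ?_) j
  · have h0 : (ContinuousLinearMap.proj (R := ℝ) (φ := fun _ : Fin (n + 1) => ℝ) 0).comp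
        (consCLM ℓ L) = ℓ := by
      ext h
      simp
    simpa [h0] using hu
  · have hi : (ContinuousLinearMap.proj (R := ℝ) (φ := fun _ : Fin (n + 1) => ℝ) i.succ).comp
        (consCLM ℓ L) = (ContinuousLinearMap.proj (R := ℝ) (φ := fun _ : Fin n => ℝ) i).comp
          (L.comp (tailCLM n)) := by
      ext h
      simp
    have := (hasFDerivWithinAt_pi'.1 hGt) i
    simpa [hi] using this

/-- The `(0,0)` entry of the block map: `consCLM ℓ L e₀ 0 = ℓ e₀`. [folklore] -/
theorem consCLM_single_zero (ℓ : (Fin (n + 1) → ℝ) →L[ℝ] ℝ) (L : (Fin n → ℝ) →L[ℝ] (Fin n → ℝ)) :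
    consCLM ℓ L (Pi.single 0 1) 0 = ℓ (Pi.single 0 1) := by
  simp

end Summit.KontsevichZagierPeriods.ScissorsTransport.PolytopeTransport
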